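import Summits.CriticalPhenomena.PercolationContinuityZ3.Theorems.PercNearOneGluingNoHeavyLowerTailChampionStabilityRelay
import Summits.CriticalPhenomena.PercolationContinuityZ3.Theorems.PercNearOneGluingAdditiveGluingOneBond
import Literature.Probability.LatticeModels.ProdBernoulliAtomExpansion
import HarnessLib

/-!
# `NoHeavyLowerTail` (stmt-CriticalPhenomena-4575) — two-port peeling: tools

Route `PercNearOneGluingNoHeavy`, seat `prim-gen-swap` (gen 5).  Support lemmas for `…NoHeavyLowerTailTwoPortPeeling.lean` (CS₂ when
the partner `v` is a two-port star): glued-vertex identities (`glued_real_count_eq`: after gluing `v` to `b`, `|π(v)|` and `|π(b)|`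
have the same law), the two-bond scenario decomposition (`real_twoBond`), pendant invariance of relay loneliness events
(`pendant_real_relay_eq`), the weights bookkeeping (`w₀₀, w₁₀, w₀₁, w₁₁` = `w` with the two port pairs pinned), the relay law of `w`
as the `θ`-mixture of `w₀₀` and `w₁₁` (`relay_law_eq`, `θ` = product of the two port weights).  `μ_w = prodBernoulli w` on `Fin n`, relays `A`, level `j`, `π(z) = {a ∈ A : z ↔ a}`,
`R_x = {|π(x)| ≤ j}`.  The gluing identity `glue_pair_identity` (hub-move = this identity + `Literature…twoObserver_le_of_lonelier`).  No definitions, no named facts,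
no sorries.
-/

noncomputable section

namespace Summit.CriticalPhenomena.PercolationContinuityZ3.Theorems

open MeasureTheory Set Literature.Probability.LatticeModels Literature.Probability.Percolation
open scoped Classical BigOperators

variable {n : ℕ}

namespace TwoPortPeeling

/-- For a relay `b ∈ A` the loneliness event `{|π(b)| ≤ j}` equals `{1 ≤ |π(b)| ≤ j}` (`b ∈ π(b)`). [folklore] -/
theorem relay_lonely_eq_small (A : Finset (Fin n)) (b : Fin n) (j : ℕ) (hb : b ∈ A) :
    {ω : BondConfig (Fin n) | (A.filter fun z => ω ∈ openConn b z).card ≤ j} =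
      {ω : BondConfig (Fin n) | 1 ≤ (A.filter fun z => ω ∈ openConn b z).card ∧
        (A.filter fun z => ω ∈ openConn b z).card ≤ j} := by
  ext ω
  simp only [mem_setOf_eq]
  constructor
  · intro h
    exact ⟨Finset.card_pos.2 ⟨b, Finset.mem_filter.2 ⟨hb, (SimpleGraph.Reachable.refl b :
      (openGraph ω).Reachable b b)⟩⟩, h⟩
  · exact fun h => h.2

open ChampionStability in
/-- **Glued-vertex identity (any statistic of the relay count).**  After gluing `v` to `b` (`w₀ s(v,b) = 0` raised to `1`),
`|π(v)|` and `|π(b)|` have the same law: for every predicate `P`, `μ(P(|π(v)|)) = μ(P(|π(b)|))` — both events pull back along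
`ω ↦ insert s(v,b) ω` to `P(|π(v) ∪ π(b)|)`. [folklore] -/
theorem glued_real_count_eq (w₀ : Sym2 (Fin n) → unitInterval) (A : Finset (Fin n)) (v b : Fin n) (P : ℕ → Prop)
    (hbv : b ≠ v) (hw : w₀ s(v, b) = 0) :
    (prodBernoulli (Function.update w₀ s(v, b) 1)).real
        {ω : BondConfig (Fin n) | P (A.filter fun z => ω ∈ openConn v z).card} =
      (prodBernoulli (Function.update w₀ s(v, b) 1)).real
        {ω : BondConfig (Fin n) | P (A.filter fun z => ω ∈ openConn b z).card} := by
  have hvb : v ≠ b := fun h => hbv h.symm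
  rw [real_update_one_eq w₀ hw, real_update_one_eq w₀ hw]
  congr 1
  ext ω
  simp only [mem_preimage, mem_setOf_eq]
  have hfv : (A.filter fun x => insert s(v, b) ω ∈ openConn v x) =
      (A.filter fun z => ω ∈ openConn v z ∨ ω ∈ openConn b z) := by
    refine Finset.filter_congr fun x _ => ?_
    exact reachable_insert_left_iff ω hvb x
  have hsw : (s(b, v) : Sym2 (Fin n)) = s(v, b) := Sym2.eq_swap
  have hfb : (A.filter fun x => insert s(v, b) ω ∈ openConn b x) =
      (A.filter fun z => ω ∈ openConn v z ∨ ω ∈ openConn b z) := by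
    refine Finset.filter_congr fun x _ => ?_
    have h := reachable_insert_left_iff ω hbv x
    rw [hsw] at h
    show (openGraph (insert s(v, b) ω)).Reachable b x ↔ (ω ∈ openConn v x ∨ ω ∈ openConn b x)
    rw [h]
    show ((openGraph ω).Reachable b x ∨ (openGraph ω).Reachable v x) ↔
      ((openGraph ω).Reachable v x ∨ (openGraph ω).Reachable b x)
    exact Or.comm
  rw [hfv, hfb]

/-- **Glued-vertex identity, loneliness.**  After gluing `v` to the relay `b`, `μ(|π(v)| ≤ j) = μ(|π(b)| ≤ j)`. [folklore] -/
theorem glued_real_lonely_eq (w₀ : Sym2 (Fin n) → unitInterval) (A : Finset (Fin n)) (v b : Fin n) (j : ℕ)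
    (hbv : b ≠ v) (_hb : b ∈ A) (hw : w₀ s(v, b) = 0) :
    (prodBernoulli (Function.update w₀ s(v, b) 1)).real
        {ω : BondConfig (Fin n) | (A.filter fun z => ω ∈ openConn v z).card ≤ j} =
      (prodBernoulli (Function.update w₀ s(v, b) 1)).real
        {ω : BondConfig (Fin n) | (A.filter fun z => ω ∈ openConn b z).card ≤ j} :=
  glued_real_count_eq w₀ A v b (fun m => m ≤ j) hbv hw


/-- Two successive one-bond decompositions: the law under `w` is the `(β,β')`-mixture of the four scenario laws in which the
pairs `e ≠ e'` are pinned to `0/1`. [folklore] -/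
theorem real_twoBond (w : Sym2 (Fin n) → unitInterval) {e e' : Sym2 (Fin n)} (hee : e ≠ e')
    (S : Set (BondConfig (Fin n))) :
    (prodBernoulli w).real S =
      (1 - (w e : ℝ)) * (1 - (w e' : ℝ)) *
          (prodBernoulli (Function.update (Function.update w e 0) e' 0)).real S
        + (w e : ℝ) * (1 - (w e' : ℝ)) *
          (prodBernoulli (Function.update (Function.update w e 1) e' 0)).real S
        + (1 - (w e : ℝ)) * (w e' : ℝ) *
          (prodBernoulli (Function.update (Function.update w e 0) e' 1)).real S
        + (w e : ℝ) * (w e' : ℝ) *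
          (prodBernoulli (Function.update (Function.update w e 1) e' 1)).real S := by
  rw [stub_oneBondDecomp_k15 n w e S, stub_oneBondDecomp_k15 n (Function.update w e 0) e' S,
    stub_oneBondDecomp_k15 n (Function.update w e 1) e' S]
  have h0 : (Function.update w e (0 : unitInterval) e' : ℝ) = w e' := by
    rw [Function.update_of_ne hee.symm]
  have h1 : (Function.update w e (1 : unitInterval) e' : ℝ) = w e' := by
    rw [Function.update_of_ne hee.symm]
  rw [h0, h1]
  ring

/-- Two sets that agree off a null set have the same (real) measure. [folklore] -/
theorem real_eq_of_agree_off_null (μ : Measure (BondConfig (Fin n))) (Z S₁ S₂ : Set (BondConfig (Fin n)))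
    (hZ : μ Z = 0) (h : ∀ ω, ω ∉ Z → (ω ∈ S₁ ↔ ω ∈ S₂)) : μ.real S₁ = μ.real S₂ := by
  apply measureReal_congr
  refine ae_eq_set.2 ⟨measure_mono_null (fun ω hω => ?_) hZ, measure_mono_null (fun ω hω => ?_) hZ⟩
  · by_contra hZ'
    exact hω.2 ((h ω hZ').1 hω.1)
  · by_contra hZ'
    exact hω.2 ((h ω hZ').2 hω.1)

/-- **Pendant invariance.**  If every pair at `v` has weight `0` in `w₀` and `b ≠ v`, raising `s(v,b)` to `1` (a pendant edge at
the otherwise isolated `v`) does not change the probability of the loneliness event `R_x` of any vertex `x ≠ v` with respect to a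
relay set `A ∌ v`. [folklore] -/
theorem pendant_real_relay_eq (w₀ : Sym2 (Fin n) → unitInterval) (A : Finset (Fin n)) (v b x : Fin n) (j : ℕ)
    (hv : v ∉ A) (hbv : b ≠ v) (hxv : x ≠ v) (h0 : ∀ y : Fin n, y ≠ v → w₀ s(v, y) = 0) :
    (prodBernoulli (Function.update w₀ s(v, b) 1)).real
        {ω : BondConfig (Fin n) | (A.filter fun z => ω ∈ openConn x z).card ≤ j} =
      (prodBernoulli w₀).real {ω : BondConfig (Fin n) | (A.filter fun z => ω ∈ openConn x z).card ≤ j} := by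
  have hvb : v ≠ b := fun h => hbv h.symm
  rw [ChampionStability.real_update_one_eq w₀ (h0 b hbv)]
  -- the null set: some pair at `v` is open
  set F : Finset (Sym2 (Fin n)) := (Finset.univ.filter fun y : Fin n => y ≠ v).image (fun y => s(v, y)) with hF
  set Z : Set (BondConfig (Fin n)) := {ω | ∃ e ∈ F, e ∈ ω} with hZ
  have hF0 : ∀ e ∈ F, (w₀ e : ℝ) = 0 := by
    intro e he
    obtain ⟨y, hy, rfl⟩ := Finset.mem_image.1 he
    have hyv : y ≠ v := (Finset.mem_filter.1 hy).2
    simp [h0 y hyv]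
  have hZ0 : prodBernoulli w₀ Z = 0 := prodBernoulli_setOf_exists_mem_eq_zero w₀ F hF0
  have hiso : ∀ ω : BondConfig (Fin n), ω ∉ Z → ∀ y : Fin n, y ≠ v → ¬ (openGraph ω).Reachable v y := by
    intro ω hω y hyv
    rintro ⟨p⟩
    cases p with
    | nil => exact hyv rfl
    | cons hadj _ =>
      rw [openGraph_adj] at hadj
      refine hω ⟨s(v, _), Finset.mem_image.2 ⟨_, Finset.mem_filter.2 ⟨Finset.mem_univ _, fun h => hadj.2 h.symm⟩, rfl⟩, hadj.1⟩
  refine real_eq_of_agree_off_null _ Z _ _ hZ0 fun ω hω => ?_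
  simp only [mem_preimage, mem_setOf_eq]
  have hfilt : (A.filter fun z => insert s(v, b) ω ∈ openConn x z) = (A.filter fun z => ω ∈ openConn x z) := by
    refine Finset.filter_congr fun z hz => ?_
    have hzv : z ≠ v := fun h => hv (h ▸ hz)
    show (openGraph (insert s(v, b) ω)).Reachable x z ↔ (openGraph ω).Reachable x z
    rw [ChampionStability.reachable_insert_iff ω hvb x z]
    constructor
    · rintro (h | ⟨⟨s₁, hs₁, h₁⟩, ⟨s₂, hs₂, h₂⟩⟩)
      · exact h
      · simp only [Finset.mem_insert, Finset.mem_singleton] at hs₁ hs₂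
        rcases hs₁ with rfl | rfl
        · exact absurd h₁.symm (hiso ω hω x hxv)
        · rcases hs₂ with rfl | rfl
          · exact absurd h₂ (hiso ω hω z hzv)
          · exact h₁.trans h₂
    · exact fun h => Or.inl h
  rw [hfilt]

/-- Function identities between the nested updates used below. [folklore] -/
theorem update_one_zero_eq (w : Sym2 (Fin n) → unitInterval) {e e' : Sym2 (Fin n)} (hee : e ≠ e') :
    Function.update (Function.update w e 1) e' 0 =
      Function.update (Function.update (Function.update w e 0) e' 0) e 1 := by
  funext x
  by_cases hx : x = e
  · subst hx; simp [hee]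
  · by_cases hx' : x = e'
    · subst hx'; simp [hx]
    · simp [hx, hx']

/-- Function identities between the nested updates used below. [folklore] -/
theorem update_one_one_eq (w : Sym2 (Fin n) → unitInterval) {e e' : Sym2 (Fin n)} (hee : e ≠ e') :
    Function.update (Function.update w e 1) e' 1 =
      Function.update (Function.update (Function.update w e 0) e' 1) e 1 := by
  funext x
  by_cases hx : x = e
  · subst hx; simp [hee]
  · by_cases hx' : x = e'
    · subst hx'; simp [hx]
    · simp [hx, hx']

/-- Function identities between the nested updates used below. [folklore] -/
theorem update_one_one_eq' (w : Sym2 (Fin n) → unitInterval) (e e' : Sym2 (Fin n)) :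
    Function.update (Function.update w e 1) e' 1 =
      Function.update (Function.update (Function.update w e 1) e' 0) e' 1 := by
  rw [Function.update_idem]



open ChampionStability in
/-- **Gluing identity for the pair events.**  For vertices `o ≠ v`, a relay `c ∈ A` and weights with `w s(o,v) = 0`: after gluing `o` to `v`,
`μ_{w[s(o,v)↦1]}(|π(c)| ≤ j) − μ_{w[s(o,v)↦1]}(1 ≤ |π(o)| ≤ j) = μ_w(c ↮ o, c ↮ v, |π(c)| ≤ j) − μ_w(c ↮ o, c ↮ v, 1 ≤ |π(o) ∪ π(v)| ≤ j)`:
on `{o ↔ c}` the two glued events coincide, off it they pull back along `ω ↦ insert s(o,v) ω` to the pair events.  (The tree's hub-move lemmas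
`HubMove.mergeStability_of_mem_of_le` / `hubMove_relayOrder` are this identity followed by `Literature…twoObserver_le_of_lonelier`.) [folklore] -/
theorem glue_pair_identity (w : Sym2 (Fin n) → unitInterval) (A : Finset (Fin n)) (o v c : Fin n) (j : ℕ)
    (hvo : v ≠ o) (hc : c ∈ A) (hw : w s(o, v) = 0) :
    (prodBernoulli (Function.update w s(o, v) 1)).real {ω : BondConfig (Fin n) |
        (A.filter fun x => ω ∈ openConn c x).card ≤ j} -
      (prodBernoulli (Function.update w s(o, v) 1)).real {ω : BondConfig (Fin n) |
        1 ≤ (A.filter fun x => ω ∈ openConn o x).card ∧ (A.filter fun x => ω ∈ openConn o x).card ≤ j} =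
    (prodBernoulli w).real {ω : BondConfig (Fin n) | ω ∉ openConn c o ∧ ω ∉ openConn c v ∧
        (A.filter fun z => ω ∈ openConn c z).card ≤ j} -
      (prodBernoulli w).real {ω : BondConfig (Fin n) | ω ∉ openConn c o ∧ ω ∉ openConn c v ∧
        1 ≤ (A.filter fun z => ω ∈ openConn o z ∨ ω ∈ openConn v z).card ∧
        (A.filter fun z => ω ∈ openConn o z ∨ ω ∈ openConn v z).card ≤ j} := by
  have hov : o ≠ v := fun h => hvo h.symm
  set μ₁ := prodBernoulli (Function.update w s(o, v) 1) with hμ₁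
  set L₁ : Set (BondConfig (Fin n)) := {ω | 1 ≤ (A.filter fun x => ω ∈ openConn o x).card ∧
      (A.filter fun x => ω ∈ openConn o x).card ≤ j} with hL₁
  set R₁ : Set (BondConfig (Fin n)) := {ω | (A.filter fun x => ω ∈ openConn c x).card ≤ j} with hR₁
  set C : Set (BondConfig (Fin n)) := openConn o c with hC
  have hsplit : ∀ S : Set (BondConfig (Fin n)), μ₁.real S = μ₁.real (S ∩ C) + μ₁.real (S \ C) :=
    fun S => (measureReal_inter_add_sdiff (μ := μ₁) (s := S) (Set.toFinite C).measurableSet).symm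
  have hLC : L₁ ∩ C = R₁ ∩ C := by
    ext ω
    simp only [hL₁, hR₁, hC, mem_inter_iff, mem_setOf_eq]
    constructor
    · rintro ⟨⟨-, h2⟩, hoc⟩
      have hoc' : (openGraph ω).Reachable o c := hoc
      have heq : (A.filter fun x => ω ∈ openConn c x) = (A.filter fun x => ω ∈ openConn o x) := by
        refine Finset.filter_congr fun x _ => ⟨fun h => ?_, fun h => ?_⟩
        · exact hoc'.trans h
        · exact hoc'.symm.trans h
      rw [heq]
      exact ⟨h2, hoc⟩
    · rintro ⟨h2, hoc⟩
      have hoc' : (openGraph ω).Reachable o c := hoc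
      have heq : (A.filter fun x => ω ∈ openConn o x) = (A.filter fun x => ω ∈ openConn c x) := by
        refine Finset.filter_congr fun x _ => ⟨fun h => ?_, fun h => ?_⟩
        · exact hoc'.symm.trans h
        · exact hoc'.trans h
      rw [heq]
      refine ⟨⟨Finset.card_pos.2 ⟨c, Finset.mem_filter.2 ⟨hc, ?_⟩⟩, h2⟩, hoc⟩
      exact SimpleGraph.Reachable.refl c
  have hLoff : μ₁.real (L₁ \ C) = (prodBernoulli w).real {ω : BondConfig (Fin n) |
      ω ∉ openConn c o ∧ ω ∉ openConn c v ∧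
      1 ≤ (A.filter fun z => ω ∈ openConn o z ∨ ω ∈ openConn v z).card ∧
      (A.filter fun z => ω ∈ openConn o z ∨ ω ∈ openConn v z).card ≤ j} := by
    rw [hμ₁, real_update_one_eq w hw]
    congr 1
    ext ω
    simp only [hL₁, hC, mem_preimage, mem_sdiff, mem_setOf_eq]
    have hfilt : (A.filter fun x => insert s(o, v) ω ∈ openConn o x) =
        (A.filter fun z => ω ∈ openConn o z ∨ ω ∈ openConn v z) := by
      refine Finset.filter_congr fun x _ => ?_
      exact reachable_insert_left_iff ω hov x
    have hco : insert s(o, v) ω ∈ openConn o c ↔ (ω ∈ openConn c o ∨ ω ∈ openConn c v) := by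
      show (openGraph (insert s(o, v) ω)).Reachable o c ↔
        ((openGraph ω).Reachable c o ∨ (openGraph ω).Reachable c v)
      rw [SimpleGraph.reachable_comm]
      exact reachable_insert_to_left_iff ω hov c
    rw [hfilt, hco]
    tauto
  have hRoff : μ₁.real (R₁ \ C) = (prodBernoulli w).real {ω : BondConfig (Fin n) |
      ω ∉ openConn c o ∧ ω ∉ openConn c v ∧ (A.filter fun z => ω ∈ openConn c z).card ≤ j} := by
    rw [hμ₁, real_update_one_eq w hw]
    congr 1
    ext ω
    simp only [hR₁, hC, mem_preimage, mem_sdiff, mem_setOf_eq]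
    have hco : insert s(o, v) ω ∈ openConn o c ↔ (ω ∈ openConn c o ∨ ω ∈ openConn c v) := by
      show (openGraph (insert s(o, v) ω)).Reachable o c ↔
        ((openGraph ω).Reachable c o ∨ (openGraph ω).Reachable c v)
      rw [SimpleGraph.reachable_comm]
      exact reachable_insert_to_left_iff ω hov c
    rw [hco]
    constructor
    · rintro ⟨hcard, hnot⟩
      have hco' : ¬ (openGraph ω).Reachable c o := fun h => hnot (Or.inl h)
      have hcv' : ¬ (openGraph ω).Reachable c v := fun h => hnot (Or.inr h)
      have hfilt : (A.filter fun x => insert s(o, v) ω ∈ openConn c x) =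
          (A.filter fun z => ω ∈ openConn c z) := by
        refine Finset.filter_congr fun x _ => ?_
        exact reachable_insert_iff_of_not ω hov hco' hcv' x
      rw [hfilt] at hcard
      exact ⟨hco', hcv', hcard⟩
    · rintro ⟨hco', hcv', hcard⟩
      have hfilt : (A.filter fun x => insert s(o, v) ω ∈ openConn c x) =
          (A.filter fun z => ω ∈ openConn c z) := by
        refine Finset.filter_congr fun x _ => ?_
        exact reachable_insert_iff_of_not ω hov hco' hcv' x
      rw [hfilt]
      exact ⟨hcard, fun h => h.elim hco' hcv'⟩
  rw [hsplit L₁, hsplit R₁, hLC, hLoff, hRoff]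
  ring

/-- The port pairs `s(v,b) ≠ s(v,b')` of a two-port star. [folklore] -/
theorem port_ne {v b b' : Fin n} (hbb' : b ≠ b') (hbv : b ≠ v) : (s(v, b) : Sym2 (Fin n)) ≠ s(v, b') := by
  intro h
  rw [Sym2.eq_iff] at h
  rcases h with ⟨-, h⟩ | ⟨-, h⟩
  · exact hbb' h
  · exact hbv h

/-- In the deleted weights `w₀₀ = w[s(v,b)↦0][s(v,b')↦0]` of a two-port star `v`, every pair at `v` has weight `0`. [folklore] -/
theorem deleted_zero_at (w : Sym2 (Fin n) → unitInterval) {v b b' : Fin n} (hbb' : b ≠ b') (hbv : b ≠ v)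
    (hvtwo : ∀ y : Fin n, y ≠ v → y ≠ b → y ≠ b' → w s(v, y) = 0) :
    ∀ y : Fin n, y ≠ v → Function.update (Function.update w s(v, b) 0) s(v, b') 0 s(v, y) = 0 := by
  have hee := port_ne hbb' hbv
  intro y hyv
  by_cases hyb : y = b
  · subst hyb
    rw [Function.update_of_ne hee, Function.update_self]
  · by_cases hyb' : y = b'
    · subst hyb'
      rw [Function.update_self]
    · have hne : (s(v, y) : Sym2 (Fin n)) ≠ s(v, b) := by
        intro h; rw [Sym2.eq_iff] at h
        rcases h with ⟨-, h⟩ | ⟨-, h⟩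
        · exact hyb h
        · exact hyv h
      have hne' : (s(v, y) : Sym2 (Fin n)) ≠ s(v, b') := by
        intro h; rw [Sym2.eq_iff] at h
        rcases h with ⟨-, h⟩ | ⟨-, h⟩
        · exact hyb' h
        · exact hyv h
      rw [Function.update_of_ne hne', Function.update_of_ne hne]
      exact hvtwo y hyv hyb hyb'

/-- **Relay law of a two-port star.**  For every vertex `x ≠ v`:
`μ_w(R_x) = (1 − θ)·μ_{w₀₀}(R_x) + θ·μ_{w₁₁}(R_x)`, `θ = w s(v,b) · w s(v,b')` — the scenarios `w₁₀, w₀₁` (one port open) have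
the relay law of `w₀₀` by pendant invariance. [this file] -/
theorem relay_law_eq (w : Sym2 (Fin n) → unitInterval) (A : Finset (Fin n)) {v b b' : Fin n} (x : Fin n) (j : ℕ)
    (hv : v ∉ A) (hbb' : b ≠ b') (hbv : b ≠ v) (hb'v : b' ≠ v) (hxv : x ≠ v)
    (hvtwo : ∀ y : Fin n, y ≠ v → y ≠ b → y ≠ b' → w s(v, y) = 0) :
    (prodBernoulli w).real {ω : BondConfig (Fin n) | (A.filter fun z => ω ∈ openConn x z).card ≤ j} =
      (1 - (w s(v, b) : ℝ) * w s(v, b')) *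
          (prodBernoulli (Function.update (Function.update w s(v, b) 0) s(v, b') 0)).real
            {ω : BondConfig (Fin n) | (A.filter fun z => ω ∈ openConn x z).card ≤ j} +
        (w s(v, b) : ℝ) * w s(v, b') *
          (prodBernoulli (Function.update (Function.update w s(v, b) 1) s(v, b') 1)).real
            {ω : BondConfig (Fin n) | (A.filter fun z => ω ∈ openConn x z).card ≤ j} := by
  have hee := port_ne hbb' hbv
  have h00 := deleted_zero_at w hbb' hbv hvtwo
  set w00 := Function.update (Function.update w s(v, b) 0) s(v, b') 0 with hw00
  have h10 : (prodBernoulli (Function.update (Function.update w s(v, b) 1) s(v, b') 0)).real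
      {ω : BondConfig (Fin n) | (A.filter fun z => ω ∈ openConn x z).card ≤ j} =
      (prodBernoulli w00).real {ω : BondConfig (Fin n) | (A.filter fun z => ω ∈ openConn x z).card ≤ j} := by
    rw [update_one_zero_eq w hee]
    exact pendant_real_relay_eq w00 A v b x j hv hbv hxv h00
  -- the other single-port scenario, with the roles of `b, b'` exchanged
  have hvtwo' : ∀ y : Fin n, y ≠ v → y ≠ b' → y ≠ b → w s(v, y) = 0 := fun y h1 h2 h3 => hvtwo y h1 h3 h2
  have h00' := deleted_zero_at w hbb'.symm hb'v hvtwo'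
  have hcomm : Function.update (Function.update w s(v, b') 0) s(v, b) 0 = w00 := by
    rw [hw00]; exact Function.update_comm hee.symm _ _ _
  have h01 : (prodBernoulli (Function.update (Function.update w s(v, b) 0) s(v, b') 1)).real
      {ω : BondConfig (Fin n) | (A.filter fun z => ω ∈ openConn x z).card ≤ j} =
      (prodBernoulli w00).real {ω : BondConfig (Fin n) | (A.filter fun z => ω ∈ openConn x z).card ≤ j} := by
    have hw : Function.update (Function.update w s(v, b) 0) s(v, b') 1 =
        Function.update (Function.update (Function.update w s(v, b') 0) s(v, b) 0) s(v, b') 1 := by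
      rw [← Function.update_comm hee, Function.update_idem]
    rw [hw, ← hcomm]
    exact pendant_real_relay_eq _ A v b' x j hv hb'v hxv h00'
  rw [real_twoBond w hee, h10, h01]
  ring

/-- **Glued-vertex identity, one port.**  `μ_{w₁₀}(R_v) = μ_{w₁₀}(R_b)` for `w₁₀ = w[s(v,b)↦1][s(v,b')↦0]`. [this file] -/
theorem glued10_real_eq (w : Sym2 (Fin n) → unitInterval) (A : Finset (Fin n)) {v b b' : Fin n} (j : ℕ)
    (hb : b ∈ A) (hbb' : b ≠ b') (hbv : b ≠ v)
    (hvtwo : ∀ y : Fin n, y ≠ v → y ≠ b → y ≠ b' → w s(v, y) = 0) :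
    (prodBernoulli (Function.update (Function.update w s(v, b) 1) s(v, b') 0)).real
        {ω : BondConfig (Fin n) | (A.filter fun z => ω ∈ openConn v z).card ≤ j} =
      (prodBernoulli (Function.update (Function.update w s(v, b) 1) s(v, b') 0)).real
        {ω : BondConfig (Fin n) | (A.filter fun z => ω ∈ openConn b z).card ≤ j} := by
  have hee := port_ne hbb' hbv
  rw [update_one_zero_eq w hee]
  exact glued_real_lonely_eq _ A v b j hbv hb (deleted_zero_at w hbb' hbv hvtwo b hbv)

/-- **Glued-vertex identity, both ports.**  `μ_{w₁₁}(R_v) = μ_{w₁₁}(R_b)` for `w₁₁ = w[s(v,b)↦1][s(v,b')↦1]`. [this file] -/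
theorem glued11_real_eq (w : Sym2 (Fin n) → unitInterval) (A : Finset (Fin n)) {v b b' : Fin n} (j : ℕ)
    (hb : b ∈ A) (hbb' : b ≠ b') (hbv : b ≠ v) :
    (prodBernoulli (Function.update (Function.update w s(v, b) 1) s(v, b') 1)).real
        {ω : BondConfig (Fin n) | (A.filter fun z => ω ∈ openConn v z).card ≤ j} =
      (prodBernoulli (Function.update (Function.update w s(v, b) 1) s(v, b') 1)).real
        {ω : BondConfig (Fin n) | (A.filter fun z => ω ∈ openConn b z).card ≤ j} := by
  have hee := port_ne hbb' hbv
  rw [update_one_one_eq w hee]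
  refine glued_real_lonely_eq _ A v b j hbv hb ?_
  rw [Function.update_of_ne hee, Function.update_self]

end TwoPortPeeling

end Summit.CriticalPhenomena.PercolationContinuityZ3.Theorems

end
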